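import Mathlib.GroupTheory.SemidirectProduct
import Mathlib.GroupTheory.SpecificGroups.Dihedral
import Mathlib.Algebra.Group.Subgroup.Pointwise
import Mathlib.Algebra.Group.Pi.Lemmas
import Mathlib.Data.ZMod.Basic
import Mathlib.Tactic.LinearCombination
import HarnessLib

/-!
# A finite model of the whole of [IUTchI] §1 — the group `N ⋊ D_l` with `N = Δ_X̲^{ab} ⊗ ℤ/l` (definitions)

Mochizuki, *Inter-universal Teichmüller theory I*, kurims manuscript (May 2020), §1 pp. 37–38
([IUTchI] §1 p.37) [claim: Mochizuki2012, status: disputed] (D-0012 claim key; series status DISPUTED —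
this file is a WITNESS-class module, pure finite group theory; nothing of the series is asserted, no side
is taken on [IUTchIII] Cor. 3.12).

PURPOSE (abc-iut-L5-t1, owner of the §1 interface `PuncturedEllipticData`; answers the WITNESS GAP NV-1 of
abc-iut-L5-t8 g4: "no inhabitant in the tree at which `ArrowCoveringClaims` fires"): the finite shadow of
the printed situation in which ALL typed §1 predicates hold simultaneously — `ArrowCoveringClaims`
(p. 38: `Δ_ε⁺ ≅ ℤ/l`, `I_{ε′} ⥲ Δ_ε⁺`, the section `σ`, the cartesian square, `Gal ≅ ℤ/l, ℤ/2l`),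
`Rmk121`, the companion `CuspGalois`, `ArrowOpenClaims`, and the Def. 3.1 (d) numerics
`[Π_X : Π_X̲] = l`, `[Π_C̲ : Π_X̲] = 2`, `Π_C̲ ⊄ Π_X` (the packaging into a `PuncturedEllipticData` and the
proofs of the claims are the sequel files `PuncturedEllipticArrowModel*.lean`).  THE MODEL (label: TOY /
finite shadow, `G_k = 1`): for a once-punctured elliptic curve `X` with `Δ_X = ⟨a, b⟩^∧` and the cyclic
covering `X̲ → X` given by `a ↦ 1 ∈ ℤ/l`, the group `Δ_X̲` is free on `a^l, b, aba⁻¹, …`, so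
`N := Δ_X̲^{ab} ⊗ ℤ/l = (ℤ/l)·A ⊕ ⨁_{i ∈ ℤ/l} (ℤ/l)·B_i` (`A = a^l`, `B_i = a^i b a^{−i}`), on which
`Gal(X̲/C) = ℤ/l ⋊ {±1} = D_l` acts by `r_k : A ↦ A, B_i ↦ B_{i+k}` and the inversion
`σ_k : A ↦ −A, B_m ↦ −B_{1−k−m}`; the `l` cusps of `X̲` have inertia `c_i := B_{i+1} − B_i` (the
conjugates `a^i [a,b] a^{−i}`), with the single relation `Σ c_i = 0`.  We take `Π_C := N ⋊ D_l`,
`Π_X := N ⋊ ⟨r⟩`, `Π_C̲ := N ⋊ ⟨s⟩` (`s = σ_0` fixes the cusp `0` and switches `±1`), decomposition groups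
`D_i := ⟨(c_i, 1)⟩`, `ε⁰, ε′, ε″, 2ε := 0, 1, −1, 2`.  Then (sequel) `Δ_ε⁺` is the quotient of `N` by
`K := {(A, f) : f(0) = f(1)}` (index `l`), `Π_{X̲→} = K`, `Π_{C̲→} = K ⋊ ⟨s⟩`.
Here (part 1): the group, the action with its formulas `φ_d(c_i) = c_{d·i}`, the subgroups `N`, `Π_X`, `Π_C̲`
and the cusp action `Π_C → D_l → Perm(ℤ/l)`; part 2 (`PuncturedEllipticArrowModelCoords.lean`) has the
`Δ_ε⁺`-coordinate, `K, K′`, the decomposition groups and the conjugation formula.  No instance, no `sorry`;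
symbolic `l` (no `decide`).
-/

namespace Literature.IUT.HodgeTheaters

namespace PuncturedEllipticData

namespace ArrowModel

open DihedralGroup
open scoped Pointwise

variable (l : ℕ)

/-! ### `N = (ℤ/l)·A ⊕ ⨁_i (ℤ/l)·B_i` and the action of `D_l` -/

/-- The additive group `(ℤ/l) × (ℤ/l)^{ℤ/l}` (coordinates `A` and `B_i`, `i ∈ ℤ/l`).
[claim: Mochizuki2012, status: disputed] -/
abbrev V : Type := ZMod l × (ZMod l → ZMod l)

/-- `N := Δ_X̲^{ab} ⊗ ℤ/l`, written multiplicatively. [claim: Mochizuki2012, status: disputed] -/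
abbrev N : Type := Multiplicative (V l)

/-- The basis vector `B_j` (as a function `ℤ/l → ℤ/l`). [claim: Mochizuki2012, status: disputed] -/
def δ (j : ZMod l) : ZMod l → ZMod l := Pi.single j 1

/-- `δ_j(m) = 1` if `m = j`, else `0`. [claim: Mochizuki2012, status: disputed] -/
theorem δ_apply (j m : ZMod l) : δ l j m = if m = j then 1 else 0 := by
  unfold δ; rw [Pi.single_apply]

/-- The inertia generator of the cusp `i`: `c_i := B_{i+1} − B_i` (abelianised `a^i [a,b] a^{−i}`).
[claim: Mochizuki2012, status: disputed] -/
def cvec (i : ZMod l) : V l := (0, δ l (i + 1) - δ l i)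

/-- The rotation `r_k`: `A ↦ A`, `B_i ↦ B_{i+k}`, i.e. `f ↦ f(· − k)`. [claim: Mochizuki2012, status: disputed] -/
def rot (k : ZMod l) : V l ≃+ V l where
  toFun p := (p.1, fun m => p.2 (m - k))
  invFun p := (p.1, fun m => p.2 (m + k))
  left_inv p := by ext m <;> simp
  right_inv p := by ext m <;> simp
  map_add' p q := by ext m <;> simp

/-- The reflection `σ_k`: `A ↦ −A`, `B_m ↦ −B_{1−k−m}`, i.e. `f ↦ (m ↦ −f(1 − k − m))` (an involution).
[claim: Mochizuki2012, status: disputed] -/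
def refl (k : ZMod l) : V l ≃+ V l where
  toFun p := (-p.1, fun m => -p.2 (1 - k - m))
  invFun p := (-p.1, fun m => -p.2 (1 - k - m))
  left_inv p := by
    ext m
    · simp
    · simp only [neg_neg, sub_sub_cancel]
  right_inv p := by
    ext m
    · simp
    · simp only [neg_neg, sub_sub_cancel]
  map_add' p q := by
    ext m
    · simp only [Prod.fst_add, neg_add]
    · simp only [Prod.snd_add, Pi.add_apply, neg_add]

/-- `rot k p` evaluated. [claim: Mochizuki2012, status: disputed] -/
@[simp] theorem rot_apply (k : ZMod l) (p : V l) : rot l k p = (p.1, fun m => p.2 (m - k)) := rfl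

/-- `refl k p` evaluated. [claim: Mochizuki2012, status: disputed] -/
@[simp] theorem refl_apply (k : ZMod l) (p : V l) : refl l k p = (-p.1, fun m => -p.2 (1 - k - m)) := rfl

/-- The action of `D_l` on `N`: `r_k ↦ rot k`, `s r_k ↦ σ_k`. [claim: Mochizuki2012, status: disputed] -/
def dact : DihedralGroup l → V l ≃+ V l
  | r k => rot l k
  | sr k => refl l k

/-- `dact (r k) = rot k`. [claim: Mochizuki2012, status: disputed] -/
@[simp] theorem dact_r (k : ZMod l) : dact l (r k) = rot l k := rfl

/-- `dact (sr k) = σ_k`. [claim: Mochizuki2012, status: disputed] -/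
@[simp] theorem dact_sr (k : ZMod l) : dact l (sr k) = refl l k := rfl

/-- The action is multiplicative (the dihedral relations hold for `rot`, `σ`).
[claim: Mochizuki2012, status: disputed] -/
theorem dact_mul (d e : DihedralGroup l) (p : V l) : dact l (d * e) p = dact l d (dact l e p) := by
  cases d <;> cases e <;>
    simp only [r_mul_r, r_mul_sr, sr_mul_r, sr_mul_sr, dact_r, dact_sr, rot_apply, refl_apply,
      neg_neg, Prod.mk.injEq, true_and] <;> funext m <;> congr 1 <;> ring

/-- The action homomorphism `φ : D_l → Aut(N)`. [claim: Mochizuki2012, status: disputed] -/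
def phi : DihedralGroup l →* MulAut (N l) where
  toFun d := AddEquiv.toMultiplicative (dact l d)
  map_one' := by
    refine MulEquiv.ext fun p => ?_
    change Multiplicative.ofAdd (dact l (r 0) (Multiplicative.toAdd p)) = p
    rw [dact_r, rot_apply]
    simp
  map_mul' d e := by
    refine MulEquiv.ext fun p => ?_
    change Multiplicative.ofAdd (dact l (d * e) (Multiplicative.toAdd p)) =
      Multiplicative.ofAdd (dact l d (Multiplicative.toAdd
        (Multiplicative.ofAdd (dact l e (Multiplicative.toAdd p)))))
    rw [toAdd_ofAdd, dact_mul]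

/-- `toAdd (φ d n) = dact d (toAdd n)`. [claim: Mochizuki2012, status: disputed] -/
theorem toAdd_phi_apply (d : DihedralGroup l) (n : N l) :
    Multiplicative.toAdd (phi l d n) = dact l d (Multiplicative.toAdd n) := rfl

/-- `φ d (ofAdd v) = ofAdd (dact d v)`. [claim: Mochizuki2012, status: disputed] -/
theorem phi_ofAdd (d : DihedralGroup l) (v : V l) :
    phi l d (Multiplicative.ofAdd v) = Multiplicative.ofAdd (dact l d v) := rfl

/-! ### The action on the inertia generators: `φ_d(c_i) = c_{d·i}` -/

/-- The action of `D_l` on the cusp labels `ℤ/l`: `r_k : i ↦ i + k`, `s r_k : i ↦ −k − i`.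
[claim: Mochizuki2012, status: disputed] -/
def cuspAct : DihedralGroup l → Equiv.Perm (ZMod l)
  | r k => Equiv.addRight k
  | sr k => Equiv.subLeft (-k)

/-- `cuspAct (r k) i = i + k`. [claim: Mochizuki2012, status: disputed] -/
@[simp] theorem cuspAct_r (k i : ZMod l) : cuspAct l (r k) i = i + k := rfl

/-- `cuspAct (sr k) i = −k − i`. [claim: Mochizuki2012, status: disputed] -/
@[simp] theorem cuspAct_sr (k i : ZMod l) : cuspAct l (sr k) i = -k - i := rfl

/-- `cuspAct` is a homomorphism `D_l → Perm(ℤ/l)`. [claim: Mochizuki2012, status: disputed] -/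
def cuspHom : DihedralGroup l →* Equiv.Perm (ZMod l) where
  toFun := cuspAct l
  map_one' := Equiv.ext fun i => by rw [one_def, cuspAct_r, add_zero, Equiv.Perm.one_apply]
  map_mul' d e := Equiv.ext fun i => by
    rw [Equiv.Perm.mul_apply]
    cases d <;> cases e <;> simp only [r_mul_r, r_mul_sr, sr_mul_r, sr_mul_sr, cuspAct_r, cuspAct_sr]
      <;> ring

/-- `rot k (c_i) = c_{i+k}`. [claim: Mochizuki2012, status: disputed] -/
theorem rot_cvec (k i : ZMod l) : rot l k (cvec l i) = cvec l (i + k) := by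
  simp only [cvec, rot_apply, Prod.mk.injEq, true_and]
  funext m
  simp only [Pi.sub_apply, δ_apply]
  have h1 : (m - k = i + 1) ↔ (m = i + k + 1) :=
    ⟨fun h => by linear_combination h, fun h => by linear_combination h⟩
  have h2 : (m - k = i) ↔ (m = i + k) :=
    ⟨fun h => by linear_combination h, fun h => by linear_combination h⟩
  simp only [h1, h2]

/-- `σ_k (c_i) = c_{−k−i}`. [claim: Mochizuki2012, status: disputed] -/
theorem refl_cvec (k i : ZMod l) : refl l k (cvec l i) = cvec l (-k - i) := by
  simp only [cvec, refl_apply, neg_zero, Prod.mk.injEq, true_and]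
  funext m
  simp only [Pi.sub_apply, δ_apply]
  have h1 : (1 - k - m = i + 1) ↔ (m = -k - i) :=
    ⟨fun h => by linear_combination -h, fun h => by linear_combination -h⟩
  have h2 : (1 - k - m = i) ↔ (m = -k - i + 1) :=
    ⟨fun h => by linear_combination -h, fun h => by linear_combination -h⟩
  simp only [h1, h2]
  ring

/-- `φ_d(c_i) = c_{d·i}` for every `d ∈ D_l`. [claim: Mochizuki2012, status: disputed] -/
theorem dact_cvec (d : DihedralGroup l) (i : ZMod l) : dact l d (cvec l i) = cvec l (cuspAct l d i) := by
  cases d with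
  | r k => rw [dact_r, rot_cvec, cuspAct_r]
  | sr k => rw [dact_sr, refl_cvec, cuspAct_sr]

/-! ### `Π_C := N ⋊ D_l` and its subgroups -/

/-- The ambient group of the model: `Π_C := N ⋊ D_l`. [claim: Mochizuki2012, status: disputed] -/
abbrev G : Type := N l ⋊[phi l] DihedralGroup l

/-- `Π_C` is finite (for `l ≠ 0`). [claim: Mochizuki2012, status: disputed] -/
theorem finite_G [NeZero l] : Finite (G l) := Finite.of_equiv _ SemidirectProduct.equivProd.symm

/-- The element `(v, 1) ∈ N ⊆ Π_C` attached to `v ∈ V`. [claim: Mochizuki2012, status: disputed] -/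
def inN (v : V l) : G l := SemidirectProduct.inl (Multiplicative.ofAdd v)

/-- `(inN v).right = 1`. [claim: Mochizuki2012, status: disputed] -/
@[simp] theorem inN_right (v : V l) : (inN l v).right = 1 := rfl

/-- `(inN v).left = ofAdd v`. [claim: Mochizuki2012, status: disputed] -/
@[simp] theorem inN_left (v : V l) : (inN l v).left = Multiplicative.ofAdd v := rfl

/-- `inN` is additive-to-multiplicative. [claim: Mochizuki2012, status: disputed] -/
theorem inN_add (v w : V l) : inN l (v + w) = inN l v * inN l w := by
  unfold inN; rw [ofAdd_add, map_mul]

/-- `inN 0 = 1`. [claim: Mochizuki2012, status: disputed] -/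
@[simp] theorem inN_zero : inN l 0 = 1 := by unfold inN; rw [ofAdd_zero, map_one]

/-- `inN (−v) = (inN v)⁻¹`. [claim: Mochizuki2012, status: disputed] -/
theorem inN_neg (v : V l) : inN l (-v) = (inN l v)⁻¹ := by unfold inN; rw [ofAdd_neg, map_inv]

/-- `inN (t • v) = (inN v)^t`. [claim: Mochizuki2012, status: disputed] -/
theorem inN_zsmul (t : ℤ) (v : V l) : inN l (t • v) = inN l v ^ t := by
  unfold inN; rw [ofAdd_zsmul, map_zpow]

/-- An element with trivial `D_l`-component is `inN` of its `N`-component. [claim: Mochizuki2012, status: disputed] -/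
theorem eq_inN_of_right_eq_one {g : G l} (hg : g.right = 1) :
    g = inN l (Multiplicative.toAdd g.left) :=
  SemidirectProduct.ext rfl hg

/-- `Π_X̲ = N` (the elements with trivial `D_l`-component). [claim: Mochizuki2012, status: disputed] -/
def Nhat : Subgroup (G l) := (SemidirectProduct.rightHom (N := N l) (φ := phi l)).ker

/-- Membership in `N`. [claim: Mochizuki2012, status: disputed] -/
theorem mem_Nhat_iff (g : G l) : g ∈ Nhat l ↔ g.right = 1 := by
  unfold Nhat; rw [MonoidHom.mem_ker, SemidirectProduct.rightHom_eq_right]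

/-- `inN v ∈ N`. [claim: Mochizuki2012, status: disputed] -/
theorem inN_mem_Nhat (v : V l) : inN l v ∈ Nhat l := (mem_Nhat_iff l _).mpr rfl

/-- `Π_X := N ⋊ ⟨r⟩`. [claim: Mochizuki2012, status: disputed] -/
def PiXm : Subgroup (G l) where
  carrier := {g | ∃ k : ZMod l, g.right = r k}
  mul_mem' := by
    rintro g h ⟨k, hk⟩ ⟨k', hk'⟩
    exact ⟨k + k', by rw [SemidirectProduct.mul_right, hk, hk', r_mul_r]⟩
  one_mem' := ⟨0, by rw [SemidirectProduct.one_right, r_zero]⟩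
  inv_mem' := by
    rintro g ⟨k, hk⟩
    exact ⟨-k, by rw [SemidirectProduct.inv_right, hk, inv_r]⟩

/-- `Π_C̲ := N ⋊ ⟨s⟩` (`s = sr 0`). [claim: Mochizuki2012, status: disputed] -/
def PiCbarm : Subgroup (G l) where
  carrier := {g | g.right = 1 ∨ g.right = sr 0}
  mul_mem' := by
    rintro g h (hg | hg) (hh | hh) <;>
      simp only [Set.mem_setOf_eq, SemidirectProduct.mul_right, hg, hh, one_mul, mul_one, sr_mul_sr,
        sub_self, r_zero, true_or, or_true]
  one_mem' := Or.inl SemidirectProduct.one_right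
  inv_mem' := by
    rintro g (hg | hg)
    · exact Or.inl (by rw [SemidirectProduct.inv_right, hg, inv_one])
    · exact Or.inr (by rw [SemidirectProduct.inv_right, hg, inv_sr])

/-- Membership in `Π_X`. [claim: Mochizuki2012, status: disputed] -/
theorem mem_PiXm_iff (g : G l) : g ∈ PiXm l ↔ ∃ k : ZMod l, g.right = r k := Iff.rfl

/-- Membership in `Π_C̲`. [claim: Mochizuki2012, status: disputed] -/
theorem mem_PiCbarm_iff (g : G l) : g ∈ PiCbarm l ↔ g.right = 1 ∨ g.right = sr 0 := Iff.rfl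

/-- `Π_X ∩ Π_C̲ = N`. [claim: Mochizuki2012, status: disputed] -/
theorem PiXm_inf_PiCbarm : PiXm l ⊓ PiCbarm l = Nhat l := by
  ext g
  rw [Subgroup.mem_inf, mem_PiXm_iff, mem_PiCbarm_iff, mem_Nhat_iff]
  constructor
  · rintro ⟨⟨k, hk⟩, h1 | h1⟩
    · exact h1
    · rw [hk] at h1; cases h1
  · intro h
    exact ⟨⟨0, by rw [h, r_zero]⟩, Or.inl h⟩

/-- An element of `Π_C̲` outside `Π_X` has `D_l`-component `s`. [claim: Mochizuki2012, status: disputed] -/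
theorem right_eq_sr_of_mem_PiCbarm {c : G l} (hc : c ∈ PiCbarm l) (hcX : c ∉ PiXm l) :
    c.right = sr 0 := by
  rcases hc with h1 | h1
  · exact absurd ⟨0, by rw [h1, r_zero]⟩ hcX
  · exact h1

/-! ### The cusp action of `Π_C` -/

/-- The cusp action of `Π_C = N ⋊ D_l`, through the quotient `D_l`. [claim: Mochizuki2012, status: disputed] -/
def actm : G l →* Equiv.Perm (ZMod l) := (cuspHom l).comp SemidirectProduct.rightHom

/-- `actm g = cuspAct g.right`. [claim: Mochizuki2012, status: disputed] -/
theorem actm_apply (g : G l) (i : ZMod l) : actm l g i = cuspAct l g.right i := rfl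

end ArrowModel

end PuncturedEllipticData

end Literature.IUT.HodgeTheaters
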